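import Literature.MathematicalPhysics.QuantumFieldTheory.BalabanImbrieJaffe1984to88.BIJ88Ineq5144TwoCubeLeaf

/-!
# `BalabanImbrieJaffe1984to88.BIJ88Ineq5144PairAdjustmentWitness` — T. Bałaban, J. Imbrie, A. Jaffe, *Effective action and cluster properties of the
abelian Higgs model*, Commun. Math. Phys. **114** (1988) 257–315 [BalabanImbrieJaffe1988], Sect. 5.14 (5.14.4) p. 309 [PDF 53] with Sect. 5.13 p. 307
[PDF 51]: **A KERNEL WITNESS THAT THE DECLARED ADJUSTMENT OF `BIJ88Ineq5144TwoCube` IS NECESSARY AT MODEL LEVEL** — in the §5.13 model, whose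
interaction terms carry only the sup-letters `|V_Y| ≤ K_Y ≤ K₁`, the located bound (5.14.4) on a two-cube polymer with print's per-derivative factor `θ`
is FALSE; print obtains the undecorated cube's small factor from an input the sup-letters do not carry (p. 307, verbatim: *"Each time some □_j's are
joined, we have s-derivatives, which produce functional derivatives, chains of covariances C_ω(α), and factors … Functional derivatives hitting
e^{−V^{(k)}(Y)} yield factors e^β(L^kε/ε₀)^{1/4−α}."*).

statement-level skeleton of published theorems with citation tags; proofs where landed; nothing here is a claim about the Yang–Mills mass gap

PDF held: `paper:balaban1988-cmp114-bij-abelian-higgs-effective-action` (journal page = PDF page + 256); p. 309, verbatim: *"Let us drop the prime, and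
prove that |g₃(H_β, X_β)| ≦ (e^β(L^kε/ε₀)^{1/4−α})^{[|H_β| + β′|X_β∖H_β|]}. (5.14.4) We use X_β∖H_β to denote the set of cubes with no (d/dt)_{γ_j}
factors, j ∈ H_β. The proof of this estimate is similar to the one for g₂."*

WHAT IS PROVED (unit `lit-balaban-p36`, generation 17 of the Phase-2 proof seat p36; HOME/GAPS.md **G-C2-p36-09**; SKELETON rows C2.Eq5.14.3-5.14.4 /
C2.Eq5.14.5 of `HOME/lit-balaban-r16/ROWS-C2-part2.md`, owner r16 — informs the wording of their flip items, moves no head).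
* §1 `integral_exp_neg_sq_div` — `⟨e^{−φ_a²}⟩_P = √(det P / det(P + 2E_{aa}))` for a positive definite precision `P` (`B2Eq228Conditioning.gaussNorm_eq`);
  §2–§3 the datum sites = cubes = `Fin 2`, `Δ = !![2,1;1,2]`: `⟨e^{−φ₀²}⟩ = √3/√7 ≤ 0.6547` under the coupled law of the pair (site-0 variance `2/3`),
  `= √4/√8 ≥ 0.707` under the decoupled one (variance `1/2`) — `integral_exp_neg_sq_coupled_decoupled`, `sqrt_window`.
* §4 **`ineq5144_locAct_pair_unadjusted_false`** — the statement of p36 g17 `BIJ88Ineq5144TwoCube.ineq5144_locAct_pair_of_struct` ((5.14.4) located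
  on `|X_β| = 2` for any coupling) with its declared adjustment `hekθ₂ : e_k ≤ θ^{1+β′}/2`, `hKθ₂ : K_Y e^{2GK₁} ≤ θ^{1+β′}/2` REPLACED by print's
  per-derivative factor `θ` (`e_k ≤ θ`, `K_Y e^{2GK₁} ≤ θ` — the one-cube kind of gen 16's `ineq5144_locAct_singleton_of_struct`), every other
  hypothesis unchanged and in the same order, IMPLIES `False`.  Witness: `ℱ = 0`, no χ-slots, ONE interaction term `V(φ) = K e^{−φ₀²}` on cube `0`
  carrying the one `(d/dt)`, cube `1` slot-free, `t = 1`, `θ = 10⁻⁵`, `β′ = 1/2`, `K = K₁ = 2·10⁻⁶`, `G = 1`, `m = Λ = 1`, `c₀ = 10`, `F = 0`,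
  `e_k = min(10⁻⁸, 1/(16Ĉ))` with `Ĉ` the all-orders constant of `gevreyCutoff`: all regime clauses hold, the located exponent gives `θ^{3/2} ≤ 3.2·10⁻⁸`,
  while by `BIJ88PairActivity309.actIn_pair_eq` the activity is `⟨−Kve^{−Kv}⟩_coupled − ⟨−Kve^{−Kv}⟩_decoupled ≥ K(e^{−K}·0.707 − 0.6547) > 10⁻⁷`
  (`v = e^{−φ₀²}`: the two one-cube Gaussian marginals differ at `O(1)`; no sup-letter makes a difference of expectations smaller than they are).
HONEST SCOPE: a statement about OUR §5.13 model's hypothesis class, not about the paper: print's p. 307 mechanism (the `s`-derivative join = IBP trains,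
(5.13.3) at `|Γ| = 1`, in tree p13 `BIJ88WalkFormOrderOne5133.dexp_singleton_walk`) uses the quoted smallness of FUNCTIONAL derivatives of
`e^{−V^{(k)}(Y)}`, which the model would have to type as new letters (`‖∇V_Y‖`, `‖∇²V_Y‖`); until then the adjustment of `BIJ88Ineq5144TwoCube` (carried
by the owner as a declared divergence from print's constants) cannot be dropped for interaction-term derivatives.  The χ-half `hekθ₂` is not
witnessed against (one Gaussian shell tail has slack).  0 `sorry`, 0 definitions, 0 `Prop` facts (D-0026); imports `BIJ88Ineq5144TwoCubeLeaf`; modifies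
nothing.  NOT summit progress; NOT continuum; NOT Clay.  Cell `lit-balaban` Phase 2, seat p36 gen 17 (owner r16, referee ref-5).
-/

noncomputable section

open Finset MeasureTheory Matrix ProbabilityTheory Filter
open Literature.MathematicalPhysics.QuantumFieldTheory.Balaban1983to89
open B2Eq228Conditioning (weight source)
open B13GaugeDevices (gaussWeight gaussNorm)
open Literature.MathematicalPhysics.QuantumFieldTheory.BalabanImbrieJaffe1984to88
open BIJ88Sect2Statements (pLog)
open BIJ88Sect5Statements (CutoffProfile cutoff)
open BIJ88DirichletForms305 (interpForm interpForm_apply)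
open BIJ88PolymerRep5134 (corner corner_apply IsConn)
open BIJ88PolymerRep5134Gauss (ext prec src)
open BIJ88SlotMoments308 (slotFactor slotFactor_inr)
open BIJ88SlotMomentsGauss308 (fieldLaw integral_fieldLaw)
open BIJ88Eq5145CornerModel (slotB slotY regionLaw prec_interp_corner prec_corner_posDef isProbabilityMeasure_regionLaw)
open BIJ88Eq5145CornerUrsell (cubeIn)
open BIJ88W6PrimeVsupp (actIn)
open BIJ88Ineq5144Located (locAct locAct_of_loc)
open BIJ88GaussIntegration309Product (exists_const_all_orders)
open BIJ88CutoffProfileWitness (gevreyCutoff chi1_nonneg)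
open BIJ88PairActivity309 (actIn_pair_eq interp_corner_posDef)
open BIJ88Ineq5144TwoCubeLeaf (fin2Coupling_posDef_and_ge)

namespace Literature.MathematicalPhysics.QuantumFieldTheory.BalabanImbrieJaffe1984to88.BIJ88Ineq5144PairAdjustmentWitness

/-! ## §1 The Gaussian expectation of `e^{−φ_a²}` -/
section Gauss

variable {S : Type} [Fintype S]

/-- `∫ e^{−½⟨φ,Pφ⟩}dφ` is the Gaussian normalisation. [cite: BalabanImbrieJaffe1988, p.304 (Sect. 5.13)] -/
theorem integral_weight_eq_gaussNorm (P : Matrix S S ℝ) : ∫ φ, weight P φ = gaussNorm P := by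
  rw [gaussNorm]
  refine integral_congr_ae (ae_of_all _ fun φ => ?_)
  rw [weight, B2Eq228Conditioning.gaussWeight_eq]

variable [DecidableEq S]

/-- `e^{−φ_a²}·e^{−½⟨φ,Pφ⟩} = e^{−½⟨φ,(P + 2E_{aa})φ⟩}`. [cite: BalabanImbrieJaffe1988, p.304 (Sect. 5.13)] -/
theorem exp_neg_sq_mul_weight (P : Matrix S S ℝ) (a : S) (φ : S → ℝ) :
    Real.exp (-(φ a) ^ 2) * weight P φ = weight (P + Matrix.single a a 2) φ := by
  rw [weight, weight, ← Real.exp_add]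
  congr 1
  rw [Matrix.add_mulVec, dotProduct_add, Matrix.single_mulVec_eq, dotProduct_smul, dotProduct_single_one, smul_eq_mul]
  ring

/-- **`⟨e^{−φ_a²}⟩_P = √(det P / det(P + 2E_{aa}))`** for a positive definite precision `P`. [cite: BalabanImbrieJaffe1988, p.304 (Sect. 5.13)] -/
theorem integral_exp_neg_sq_div (P : Matrix S S ℝ) (hP : P.PosDef) (a : S) :
    (∫ φ, Real.exp (-(φ a) ^ 2) * weight P φ) / (∫ φ, weight P φ) =
      Real.sqrt P.det / Real.sqrt (P + Matrix.single a a 2).det := by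
  have hE : (Matrix.single a a (2 : ℝ)).PosSemidef := by
    rw [← Matrix.diagonal_single]
    exact Matrix.PosSemidef.diagonal fun i => by
      rcases eq_or_ne i a with rfl | h
      · simp
      · simp [h]
  have hP' : (P + Matrix.single a a 2).PosDef := hP.add_posSemidef hE
  simp_rw [exp_neg_sq_mul_weight]
  rw [integral_weight_eq_gaussNorm, integral_weight_eq_gaussNorm, B2Eq228Conditioning.gaussNorm_eq hP',
    B2Eq228Conditioning.gaussNorm_eq hP]
  have h1 : 0 < Real.sqrt (2 * Real.pi) ^ Fintype.card S := pow_pos (Real.sqrt_pos.2 (by positivity)) _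
  have h2 : 0 < Real.sqrt P.det := Real.sqrt_pos.2 hP.det_pos
  have h3 : 0 < Real.sqrt (P + Matrix.single a a 2).det := Real.sqrt_pos.2 hP'.det_pos
  field_simp

end Gauss

/-! ## §2 The datum: two abutting one-site cubes with the coupled precision `!![2,1;1,2]` -/
section Datum

/-- the interpolated form at the full corner is the form itself (one site per cube). [cite: BalabanImbrieJaffe1988, p.305 (Sect. 5.13)] -/
theorem interpForm_id_corner_pair (M : Matrix (Fin 2) (Fin 2) ℝ) :
    interpForm (id : Fin 2 → Fin 2) M (corner ℝ ({0, 1} : Finset (Fin 2))) = M := by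
  have hmem : ∀ z : Fin 2, z ∈ ({0, 1} : Finset (Fin 2)) := by decide
  ext x y
  rw [interpForm_apply]
  split_ifs with h
  · rfl
  · simp [corner_apply, hmem]

/-- the interpolated form at the empty corner is the block-diagonal part (one site per cube). [cite: BalabanImbrieJaffe1988, p.305 (Sect. 5.13)] -/
theorem interpForm_id_corner_empty (M : Matrix (Fin 2) (Fin 2) ℝ) :
    interpForm (id : Fin 2 → Fin 2) M (corner ℝ (∅ : Finset (Fin 2))) = Matrix.diagonal fun x => M x x := by
  ext x y
  rw [interpForm_apply, Matrix.diagonal_apply]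
  by_cases h : x = y
  · subst h; simp
  · simp [h, corner_apply]

/-- the four determinants of the witness: `det Δ = 3`, `det(Δ + 2E₀₀) = 7`, `det Δ_D = 4`, `det(Δ_D + 2E₀₀) = 8`.
[cite: BalabanImbrieJaffe1988, p.305 (Sect. 5.13)] -/
theorem dets :
    (!![2, 1; 1, 2] : Matrix (Fin 2) (Fin 2) ℝ).det = 3 ∧ ((!![2, 1; 1, 2] : Matrix (Fin 2) (Fin 2) ℝ) + Matrix.single 0 0 2).det = 7 ∧
    (Matrix.diagonal fun x : Fin 2 => (!![2, 1; 1, 2] : Matrix (Fin 2) (Fin 2) ℝ) x x).det = 4 ∧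
    ((Matrix.diagonal fun x : Fin 2 => (!![2, 1; 1, 2] : Matrix (Fin 2) (Fin 2) ℝ) x x) + Matrix.single 0 0 2).det = 8 := by
  have h1 : (!![2, 1; 1, 2] : Matrix (Fin 2) (Fin 2) ℝ) + Matrix.single 0 0 2 = !![4, 1; 1, 2] := by
    ext i j; fin_cases i <;> fin_cases j <;> norm_num [Matrix.single_apply]
  have h2 : (Matrix.diagonal fun x : Fin 2 => (!![2, 1; 1, 2] : Matrix (Fin 2) (Fin 2) ℝ) x x) = !![2, 0; 0, 2] := by
    ext i j; fin_cases i <;> fin_cases j <;> simp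
  have h3 : (!![2, 0; 0, 2] : Matrix (Fin 2) (Fin 2) ℝ) + Matrix.single 0 0 2 = !![4, 0; 0, 2] := by
    ext i j; fin_cases i <;> fin_cases j <;> norm_num [Matrix.single_apply]
  rw [h1, h2, h3, Matrix.det_fin_two_of, Matrix.det_fin_two_of, Matrix.det_fin_two_of, Matrix.det_fin_two_of]; norm_num

/-- transport of the region precisions to `Fin 2`: determinants of `N|_sites` and of `N|_sites + 2E_{00}`.
[cite: BalabanImbrieJaffe1988, p.305 (Sect. 5.13)] -/
theorem det_submatrix_pair (N : Matrix (Fin 2) (Fin 2) ℝ) :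
    (N.submatrix (Subtype.val : BIJ88PolymerRep5134Gauss.Site (id : Fin 2 → Fin 2) ({0, 1} : Finset (Fin 2)) → Fin 2) Subtype.val).det = N.det ∧
    (N.submatrix (Subtype.val : BIJ88PolymerRep5134Gauss.Site (id : Fin 2 → Fin 2) ({0, 1} : Finset (Fin 2)) → Fin 2) Subtype.val +
        Matrix.single (⟨0, by simp⟩ : BIJ88PolymerRep5134Gauss.Site (id : Fin 2 → Fin 2) ({0, 1} : Finset (Fin 2))) (⟨0, by simp⟩ : BIJ88PolymerRep5134Gauss.Site (id : Fin 2 → Fin 2) ({0, 1} : Finset (Fin 2))) 2).det =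
      (N + Matrix.single 0 0 2).det := by
  have hmem : ∀ z : Fin 2, (id z) ∈ ({0, 1} : Finset (Fin 2)) := by decide
  set e : BIJ88PolymerRep5134Gauss.Site (id : Fin 2 → Fin 2) ({0, 1} : Finset (Fin 2)) ≃ Fin 2 := Equiv.subtypeUnivEquiv hmem with he
  have hval : (Subtype.val : BIJ88PolymerRep5134Gauss.Site (id : Fin 2 → Fin 2) ({0, 1} : Finset (Fin 2)) → Fin 2) = e := rfl
  refine ⟨by rw [hval, Matrix.det_submatrix_equiv_self], ?_⟩
  have h0 : (⟨0, by simp⟩ : BIJ88PolymerRep5134Gauss.Site (id : Fin 2 → Fin 2) ({0, 1} : Finset (Fin 2))) = e.symm 0 := rfl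
  rw [hval, h0, ← Matrix.submatrix_single_equiv e e,
    show N.submatrix e e + (Matrix.single 0 0 (2 : ℝ)).submatrix e e = (N + Matrix.single 0 0 2).submatrix e e from rfl,
    Matrix.det_submatrix_equiv_self]

/-! ## §3 The Gaussian expectations of `e^{−φ₀²}` under the coupled and the decoupled region laws -/

/-- `⟨e^{−φ₀²}⟩` under the law of the fields of the two cubes at the corner `1_{Λ′}` of `Δ = !![2,1;1,2]`: `√(det Δ_{1_{Λ′}} / det(Δ_{1_{Λ′}} + 2E₀₀))`.
[cite: BalabanImbrieJaffe1988, p.306 (Sect. 5.13); (5.14.3) p.309] -/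
theorem integral_exp_neg_sq_regionLaw (Λ' : Finset (Fin 2)) :
    ∫ ω, Real.exp (-(ω ⟨0, by simp⟩) ^ 2) ∂(regionLaw (id : Fin 2 → Fin 2) (!![2, 1; 1, 2] : Matrix (Fin 2) (Fin 2) ℝ) (0 : Fin 2 → ℝ)
        ({0, 1} : Finset (Fin 2)) Λ') =
      Real.sqrt (interpForm (id : Fin 2 → Fin 2) (!![2, 1; 1, 2] : Matrix (Fin 2) (Fin 2) ℝ) (corner ℝ Λ')).det /
        Real.sqrt (interpForm (id : Fin 2 → Fin 2) (!![2, 1; 1, 2] : Matrix (Fin 2) (Fin 2) ℝ) (corner ℝ Λ') + Matrix.single 0 0 2).det := by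
  obtain ⟨hΔ, -⟩ := fin2Coupling_posDef_and_ge
  have hsrc : ∀ φ : BIJ88PolymerRep5134Gauss.Site (id : Fin 2 → Fin 2) ({0, 1} : Finset (Fin 2)) → ℝ,
      source (src (id : Fin 2 → Fin 2) (0 : Fin 2 → ℝ) ({0, 1} : Finset (Fin 2))) φ = 1 := fun φ => by
    simp [source, BIJ88PolymerRep5134Gauss.src]
  have hP := prec_corner_posDef (id : Fin 2 → Fin 2) (!![2, 1; 1, 2] : Matrix (Fin 2) (Fin 2) ℝ) hΔ ({0, 1} : Finset (Fin 2)) Λ'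
  rw [regionLaw, integral_fieldLaw, prec_interp_corner]
  simp only [hsrc, mul_one]
  rw [integral_exp_neg_sq_div _ hP ⟨0, by simp⟩]
  obtain ⟨h1, h2⟩ := det_submatrix_pair (interpForm (id : Fin 2 → Fin 2) (!![2, 1; 1, 2] : Matrix (Fin 2) (Fin 2) ℝ) (corner ℝ Λ'))
  rw [show prec (id : Fin 2 → Fin 2) (!![2, 1; 1, 2] : Matrix (Fin 2) (Fin 2) ℝ) ({0, 1} : Finset (Fin 2)) (corner ℝ Λ') =
      (interpForm (id : Fin 2 → Fin 2) (!![2, 1; 1, 2] : Matrix (Fin 2) (Fin 2) ℝ) (corner ℝ Λ')).submatrix Subtype.val Subtype.val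
      from rfl, h1, h2]

/-- **the two values**: `⟨e^{−φ₀²}⟩_coupled = √3/√7 ≈ 0.6547` (site-0 variance `2/3`), `⟨e^{−φ₀²}⟩_decoupled = √4/√8 = 1/√2 ≈ 0.7071`
(variance `1/2`). [cite: BalabanImbrieJaffe1988, p.306 (Sect. 5.13); (5.14.3) p.309] -/
theorem integral_exp_neg_sq_coupled_decoupled :
    (∫ ω, Real.exp (-(ω ⟨0, by simp⟩) ^ 2) ∂(regionLaw (id : Fin 2 → Fin 2) (!![2, 1; 1, 2] : Matrix (Fin 2) (Fin 2) ℝ)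
        (0 : Fin 2 → ℝ) ({0, 1} : Finset (Fin 2)) ({0, 1} : Finset (Fin 2))) = Real.sqrt 3 / Real.sqrt 7) ∧
    (∫ ω, Real.exp (-(ω ⟨0, by simp⟩) ^ 2) ∂(regionLaw (id : Fin 2 → Fin 2) (!![2, 1; 1, 2] : Matrix (Fin 2) (Fin 2) ℝ)
        (0 : Fin 2 → ℝ) ({0, 1} : Finset (Fin 2)) (∅ : Finset (Fin 2))) = Real.sqrt 4 / Real.sqrt 8) := by
  obtain ⟨d1, d2, d3, d4⟩ := dets
  refine ⟨?_, ?_⟩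
  · rw [integral_exp_neg_sq_regionLaw, interpForm_id_corner_pair, d1, d2]
  · rw [integral_exp_neg_sq_regionLaw, interpForm_id_corner_empty, d3, d4]

/-- the numerical window: `√3/√7 ≤ 0.6547` and `0.707 ≤ √4/√8`. [cite: BalabanImbrieJaffe1988, (5.14.4) p.309] -/
theorem sqrt_window : Real.sqrt 3 / Real.sqrt 7 ≤ 6547 / 10000 ∧ (707 : ℝ) / 1000 ≤ Real.sqrt 4 / Real.sqrt 8 := by
  constructor
  · rw [← Real.sqrt_div (by norm_num : (0 : ℝ) ≤ 3)]
    calc Real.sqrt (3 / 7) ≤ Real.sqrt ((6547 / 10000) ^ 2) := Real.sqrt_le_sqrt (by norm_num)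
      _ = 6547 / 10000 := Real.sqrt_sq (by norm_num)
  · rw [← Real.sqrt_div (by norm_num : (0 : ℝ) ≤ 4)]
    calc (707 : ℝ) / 1000 = Real.sqrt ((707 / 1000) ^ 2) := (Real.sqrt_sq (by norm_num)).symm
      _ ≤ Real.sqrt (4 / 8) := Real.sqrt_le_sqrt (by norm_num)

end Datum

/-! ## §4 The two-cube bound (5.14.4) with print's per-derivative factor `θ` FAILS on the datum -/
section Main

/-- **NO-GO: (5.14.4) located on a two-cube polymer is FALSE in the §5.13 model with print's per-derivative factor `θ`** — the statement of
`BIJ88Ineq5144TwoCube.ineq5144_locAct_pair_of_struct` with `hekθ₂`/`hKθ₂` (`… ≤ θ^{1+β′}/2`) REPLACED by `e_k ≤ θ`, `K_Y e^{2GK₁} ≤ θ` (the one-cube kind),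
everything else unchanged and in the same order, implies `False`: refuted by the datum of §2–§3 (one interaction term `K e^{−φ₀²}` on cube `0` carrying
the one `(d/dt)`, cube `1` slot-free, `θ = 10⁻⁵`, `β′ = 1/2`, `K = K₁ = 2·10⁻⁶`, `t = G = m = Λ = 1`, `c₀ = 10`, `F = 0`, `e_k = min(10⁻⁸, 1/(16Ĉ))`):
located exponent `θ^{3/2} ≤ 3.2·10⁻⁸` vs activity `≥ K(e^{−K}·0.707 − 0.6547) > 10⁻⁷`.  Print is NOT at issue (p. 307: the join's functional derivatives
hitting `e^{−V^{(k)}(Y)}` are small by a sentence the model's sup-letters do not carry; HOME/GAPS.md G-C2-p36-09).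
[cite: BalabanImbrieJaffe1988, (5.14.4) p.309; p.307 (Sect. 5.13)] -/
theorem ineq5144_locAct_pair_unadjusted_false :
    ¬ (∀ (α I : Type) [Fintype α] [DecidableEq α] [Fintype I] [DecidableEq I] (blk : α → I) (Δ : Matrix α α ℝ) (ℱ : α → ℝ)
        (adj : I → I → Prop) [DecidableRel adj] (χ : CutoffProfile) (ι υ : Type) [Fintype ι] [DecidableEq ι] [Fintype υ] [DecidableEq υ]
        (p ek : ℝ) (B : Finset ι) (Φ : ι → (α → ℝ) → ℝ) (c : ι → ℝ) (Ys : Finset υ) (V : υ → (α → ℝ) → ℝ) (cube : ↥B ⊕ ↥Ys → I)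
        (n₀ : ℕ) (C : ℝ), 1 / 2 < p → 1 ≤ C →
        (∀ i, i ≤ n₀ → ∀ (A : ℝ) ⦃q e t : ℝ⦄, q ≠ 0 → 0 < e → 0 < t → t * e ≤ Real.exp (-1) →
          |iteratedDeriv i (fun s => cutoff χ (q * pLog p (s * e)) A) t| ≤ C * t ^ (-(i : ℤ))) →
        Δ.PosDef → ∀ (m : ℝ), 0 < m → (∀ φ : α → ℝ, m * (φ ⬝ᵥ φ) ≤ φ ⬝ᵥ (Δ *ᵥ φ)) → (∀ x, 0 ≤ χ.χ₁ x) →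
        ∀ (c₀ : ℝ), 0 < c₀ → (∀ b ∈ B, c₀ ≤ c b) → ∀ (Λ : ℝ), 0 < Λ →
        (∀ b ∈ B, ∃ ℓ₁ ℓ₂ : (α → ℝ) → ℝ, IsLinearMap ℝ ℓ₁ ∧ IsLinearMap ℝ ℓ₂ ∧
          ((∀ φ, Φ b φ = ℓ₁ φ) ∨ (∀ φ, Φ b φ = Real.sqrt (ℓ₁ φ ^ 2 + ℓ₂ φ ^ 2))) ∧
          (∀ φ, |ℓ₁ φ| ≤ Λ * Real.sqrt (φ ⬝ᵥ φ)) ∧ (∀ φ, |ℓ₂ φ| ≤ Λ * Real.sqrt (φ ⬝ᵥ φ))) →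
        ∀ (F : ℝ), 0 ≤ F → (∀ i : I, src blk ℱ {i} ⬝ᵥ src blk ℱ {i} ≤ F ^ 2) → (∀ Y ∈ Ys, Measurable (V Y)) →
        ∀ (KY : υ → ℝ), (∀ Y ∈ Ys, ∀ φ, |V Y φ| ≤ KY Y) → ∀ (K₁ : ℝ), 0 ≤ K₁ → (∀ Y ∈ Ys, KY Y ≤ K₁) →
        ∀ (G : ℕ), (∀ i, (univ.filter fun τ : ↥B ⊕ ↥Ys => cube τ = i).card ≤ G) → 0 < ek → ek ≤ Real.exp (-1) →
        ∀ (θ β' : ℝ), 0 < θ → θ ≤ 1 → 0 ≤ β' →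
        ((n₀ : ℝ) + 1 ≤ m / (8 * Λ ^ 2) * (81 / 100) * c₀ ^ 2 * Real.log ek⁻¹ ^ (2 * p - 1)) →
        (C ^ n₀ * (4 * Real.exp (F ^ 2 / m)) * Real.exp (2 * G * K₁) * ek ≤ 1) →
        (Real.exp (2 * G * K₁) * (2 * G) * (4 * Real.exp (F ^ 2 / m)) * ek + (Real.exp (2 * G * K₁) - 1) ≤ θ ^ (2 * β') / 2) →
        ek ≤ θ → (∀ Y ∈ Ys, KY Y * Real.exp (2 * G * K₁) ≤ θ) →
        ∀ (Λc X : Finset I) (t : ℝ), t ∈ Set.Ioc (0 : ℝ) 1 → ∀ (L : Type) [Fintype L] [DecidableEq L], Fintype.card L ≤ n₀ →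
        ∀ (γ : L → ↥(slotB B Ys cube X) ⊕ ↥(slotY B Ys cube X)) (H : Finset L) (X₂ : Finset I), X₂.card = 2 →
        |locAct (cubeIn cube X ∘ γ) (actIn blk Δ ℱ adj χ p ek B Φ c Ys V cube Λc X t γ) H X₂| ≤
          θ ^ ((H.card : ℝ) + β' * ((X₂ \ H.image (cubeIn cube X ∘ γ)).card : ℝ))) := by
  intro h
  classical
  obtain ⟨C, hC1, hC⟩ := exists_const_all_orders gevreyCutoff 1 1
  obtain ⟨hΔ, hΔm⟩ := fin2Coupling_posDef_and_ge
  have hmem : ∀ z : Fin 2, z ∈ ({0, 1} : Finset (Fin 2)) := by decide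
  -- the constants
  have hC0 : 0 < C := by linarith
  set K : ℝ := 2 / 10 ^ 6 with hK
  set θ : ℝ := 1 / 10 ^ 5 with hθ
  set ek : ℝ := min (1 / 10 ^ 8) (1 / (16 * C)) with hekdef
  have hK0 : 0 < K := by rw [hK]; norm_num
  have hθ0 : 0 < θ := by rw [hθ]; norm_num
  have hθ1 : θ ≤ 1 := by rw [hθ]; norm_num
  have hek0 : 0 < ek := lt_min (by norm_num) (by positivity)
  have hek8 : ek ≤ 1 / 10 ^ 8 := min_le_left _ _
  have hekC : ek ≤ 1 / (16 * C) := min_le_right _ _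
  have he3 : Real.exp 1 < 3 := lt_trans Real.exp_one_lt_d9 (by norm_num)
  have hek1 : ek ≤ Real.exp (-1) := by
    have : (1 : ℝ) / 3 ≤ Real.exp (-1) := by rw [Real.exp_neg, inv_eq_one_div]; exact one_div_le_one_div_of_le (Real.exp_pos 1) he3.le
    linarith
  have heK : Real.exp (2 * ((1 : ℕ) : ℝ) * K) ≤ 3 := le_trans (Real.exp_le_exp.2 (by rw [hK]; norm_num)) he3.le
  have heK' : Real.exp (2 * ((1 : ℕ) : ℝ) * K) - 1 ≤ 2 * K + (2 * K) ^ 2 := by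
    have h2 := (abs_le.1 (Real.abs_exp_sub_one_sub_id_le (show |2 * K| ≤ 1 by rw [abs_of_pos (by positivity), hK]; norm_num))).2
    rw [show 2 * ((1 : ℕ) : ℝ) * K = 2 * K by simp]; linarith
  -- the datum: no χ-slots, one interaction term on cube 0
  let cube₀ : ↥(∅ : Finset Unit) ⊕ ↥(univ : Finset Unit) → Fin 2 := fun _ => 0
  have hY0 : (⟨(), mem_univ _⟩ : ↥(univ : Finset Unit)) ∈ slotY (∅ : Finset Unit) (univ : Finset Unit) cube₀ ({0, 1} : Finset (Fin 2)) :=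
    mem_filter.2 ⟨mem_univ _, hmem _⟩
  let γ₀ : Unit → ↥(slotB (∅ : Finset Unit) (univ : Finset Unit) cube₀ ({0, 1} : Finset (Fin 2))) ⊕
      ↥(slotY (∅ : Finset Unit) (univ : Finset Unit) cube₀ ({0, 1} : Finset (Fin 2))) := fun _ => Sum.inr ⟨_, hY0⟩
  have hF : ∀ i : Fin 2, src (id : Fin 2 → Fin 2) (0 : Fin 2 → ℝ) {i} ⬝ᵥ src (id : Fin 2 → Fin 2) (0 : Fin 2 → ℝ) {i} ≤ (0 : ℝ) ^ 2 :=
    fun i => by simp [BIJ88PolymerRep5134Gauss.src, dotProduct]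
  have hVm : Measurable fun φ : Fin 2 → ℝ => K * Real.exp (-(φ 0) ^ 2) := Continuous.measurable (by fun_prop)
  have hVb : ∀ φ : Fin 2 → ℝ, |K * Real.exp (-(φ 0) ^ 2)| ≤ K := fun φ => by
    rw [abs_of_nonneg (by positivity)]
    exact mul_le_of_le_one_right hK0.le (Real.exp_le_one_iff.2 (neg_nonpos.2 (sq_nonneg _)))
  have hG : ∀ i : Fin 2, (univ.filter fun τ : ↥(∅ : Finset Unit) ⊕ ↥(univ : Finset Unit) => cube₀ τ = i).card ≤ 1 := fun i =>
    (card_le_univ _).trans (by simp)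
  -- the regime inequalities of the unadjusted statement
  have hreg : (((1 : ℕ) : ℝ) + 1 ≤ 1 / (8 * (1 : ℝ) ^ 2) * (81 / 100) * (10 : ℝ) ^ 2 * Real.log ek⁻¹ ^ (2 * (1 : ℝ) - 1)) := by
    have hinv : (10 : ℝ) ^ 8 ≤ ek⁻¹ := by rw [le_inv_comm₀ (by positivity) hek0]; rw [one_div] at hek8; exact hek8
    have hlog : 1 ≤ Real.log ek⁻¹ := by rw [Real.le_log_iff_exp_le (inv_pos.2 hek0)]; linarith
    rw [show (2 : ℝ) * 1 - 1 = 1 by norm_num, Real.rpow_one, show (1 : ℝ) / (8 * 1 ^ 2) * (81 / 100) * 10 ^ 2 = 81 / 8 by norm_num,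
      Nat.cast_one]
    linarith
  have hpre₂ : C ^ 1 * (4 * Real.exp ((0 : ℝ) ^ 2 / 1)) * Real.exp (2 * ((1 : ℕ) : ℝ) * K) * ek ≤ 1 := by
    have h1 : C ^ 1 * (4 * Real.exp ((0 : ℝ) ^ 2 / 1)) * Real.exp (2 * ((1 : ℕ) : ℝ) * K) * ek ≤ C * 4 * 3 * (1 / (16 * C)) := by
      rw [pow_one, show Real.exp ((0 : ℝ) ^ 2 / 1) = 1 by simp, mul_one]
      gcongr
    have h2 : C * 4 * 3 * (1 / (16 * C)) = 3 / 4 := by field_simp; ring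
    linarith
  have hvac₂ : Real.exp (2 * ((1 : ℕ) : ℝ) * K) * (2 * ((1 : ℕ) : ℝ)) * (4 * Real.exp ((0 : ℝ) ^ 2 / 1)) * ek +
      (Real.exp (2 * ((1 : ℕ) : ℝ) * K) - 1) ≤ θ ^ (2 * (1 / 2 : ℝ)) / 2 := by
    have h0 : Real.exp ((0 : ℝ) ^ 2 / 1) = 1 := by simp
    rw [h0, mul_one, show (2 : ℝ) * (1 / 2) = 1 by norm_num, Real.rpow_one]
    have h1 : Real.exp (2 * ((1 : ℕ) : ℝ) * K) * (2 * ((1 : ℕ) : ℝ)) * 4 * ek ≤ 3 * (2 * 1) * 4 * (1 / 10 ^ 8) := by gcongr; simp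
    rw [hθ, hK] at *
    nlinarith
  have hekθ : ek ≤ θ := by rw [hθ]; linarith
  have hKθ : ∀ Y ∈ (univ : Finset Unit), K * Real.exp (2 * ((1 : ℕ) : ℝ) * K) ≤ θ := fun _ _ => by
    calc K * Real.exp (2 * ((1 : ℕ) : ℝ) * K) ≤ K * 3 := by gcongr
      _ ≤ θ := by rw [hK, hθ]; norm_num
  -- the unadjusted statement on the datum
  have hmain := h (Fin 2) (Fin 2) id (!![2, 1; 1, 2]) 0 (fun x y => x ≠ y) gevreyCutoff Unit Unit 1 ek ∅ (fun _ _ => 0) (fun _ => 1) univ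
    (fun _ φ => K * Real.exp (-(φ 0) ^ 2)) cube₀ 1 C (by norm_num) hC1 hC hΔ 1 one_pos hΔm chi1_nonneg 10 (by norm_num)
    (fun b hb => absurd hb (notMem_empty _)) 1 one_pos (fun b hb => absurd hb (notMem_empty _)) 0 le_rfl hF (fun _ _ => hVm) (fun _ => K)
    (fun _ _ φ => hVb φ) K hK0.le (fun _ _ => le_rfl) 1 hG hek0 hek1 θ (1 / 2) hθ0 hθ1 (by norm_num) hreg hpre₂ hvac₂ hekθ hKθ
    {0, 1} {0, 1} 1 ⟨one_pos, le_rfl⟩ Unit (by simp) γ₀ univ {0, 1} (card_pair (show (0 : Fin 2) ≠ 1 by decide))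
  -- evaluate the located activity of the pair: coupled minus decoupled expectation of the one differentiated slot
  have hconn : IsConn (fun x y : Fin 2 => x ≠ y) ({0, 1} : Finset (Fin 2)) := by decide
  have hT : (univ.filter fun τ : ↥(slotB (∅ : Finset Unit) (univ : Finset Unit) cube₀ ({0, 1} : Finset (Fin 2))) ⊕
      ↥(slotY (∅ : Finset Unit) (univ : Finset Unit) cube₀ ({0, 1} : Finset (Fin 2))) =>
        cubeIn cube₀ ({0, 1} : Finset (Fin 2)) τ ∈ ({0, 1} : Finset (Fin 2))) = {Sum.inr ⟨_, hY0⟩} := by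
    ext τ
    simp only [mem_filter, mem_univ, true_and, mem_singleton]
    refine ⟨fun _ => ?_, fun _ => hmem _⟩
    rcases τ with ⟨⟨b, hb⟩, _⟩ | ⟨⟨u, hu⟩, hY⟩
    · exact absurd hb (notMem_empty _)
    · rfl
  have hcard : (univ.filter fun l : Unit => γ₀ l = Sum.inr ⟨_, hY0⟩).card = 1 := by
    rw [filter_true_of_mem fun l _ => rfl, card_univ, Fintype.card_unit]
  have hext : ∀ ω : BIJ88PolymerRep5134Gauss.Site (id : Fin 2 → Fin 2) ({0, 1} : Finset (Fin 2)) → ℝ,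
      ext (id : Fin 2 → Fin 2) ({0, 1} : Finset (Fin 2)) ω 0 = ω ⟨0, hmem 0⟩ := fun ω => by simp [BIJ88PolymerRep5134Gauss.ext]
  have hderiv : ∀ a : ℝ, deriv (fun s : ℝ => Real.exp (-(s * a))) 1 = -(a * Real.exp (-a)) := fun a => by
    have hd : HasDerivAt (fun s : ℝ => Real.exp (-(s * a))) (Real.exp (-(1 * a)) * (-(1 * a))) 1 :=
      (((hasDerivAt_id (1 : ℝ)).mul_const a).neg).exp
    rw [hd.deriv]; ring_nf
  rw [locAct_of_loc (fun j _ => hmem _), actIn_pair_eq _ _ _ _ _ _ _ _ _ _ _ _ _ _ _ _ _ _ (show (0 : Fin 2) ≠ 1 by decide),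
    if_pos hconn] at hmain
  simp only [hT, prod_singleton, hcard, slotFactor_inr, iteratedDeriv_one, hderiv, hext, interpForm_id_corner_pair] at hmain
  -- the two laws and the two expectations
  obtain ⟨v, hv⟩ : ∃ v : (BIJ88PolymerRep5134Gauss.Site (id : Fin 2 → Fin 2) ({0, 1} : Finset (Fin 2)) → ℝ) → ℝ, v = fun ω => Real.exp (-(ω ⟨0, hmem 0⟩) ^ 2) := ⟨_, rfl⟩
  have hvfold : ∀ ω : BIJ88PolymerRep5134Gauss.Site (id : Fin 2 → Fin 2) ({0, 1} : Finset (Fin 2)) → ℝ, Real.exp (-(ω ⟨0, hmem 0⟩) ^ 2) = v ω := fun ω => by rw [hv]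
  simp only [hvfold] at hmain
  haveI hP : ∀ Λ', IsProbabilityMeasure (regionLaw (id : Fin 2 → Fin 2) (!![2, 1; 1, 2] : Matrix (Fin 2) (Fin 2) ℝ) (0 : Fin 2 → ℝ)
      ({0, 1} : Finset (Fin 2)) Λ') := fun Λ' => isProbabilityMeasure_regionLaw _ _ _ hΔ _ Λ'
  obtain ⟨hJ1, hJ0⟩ := integral_exp_neg_sq_coupled_decoupled
  simp only [hvfold] at hJ1 hJ0
  obtain ⟨hw1, hw0⟩ := sqrt_window
  have hvc : Continuous v := by rw [hv]; fun_prop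
  have hv0 : ∀ ω, 0 < v ω := fun ω => by rw [hv]; exact Real.exp_pos _
  have hv1 : ∀ ω, v ω ≤ 1 := fun ω => by rw [hv]; exact Real.exp_le_one_iff.2 (neg_nonpos.2 (sq_nonneg _))
  have hgc : Continuous fun ω => -(K * v ω * Real.exp (-(K * v ω))) := by fun_prop
  have hint : ∀ (μ : Measure (BIJ88PolymerRep5134Gauss.Site (id : Fin 2 → Fin 2) ({0, 1} : Finset (Fin 2)) → ℝ)) [IsProbabilityMeasure μ] (g : _ → ℝ),
      Continuous g → (∀ ω, |g ω| ≤ K) → Integrable g μ := fun μ _ g hg hb =>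
    (integrable_const K).mono' hg.aestronglyMeasurable (ae_of_all _ fun ω => by rw [Real.norm_eq_abs]; exact hb ω)
  have hKv : ∀ ω, 0 ≤ K * v ω ∧ K * v ω ≤ K := fun ω => ⟨by have := hv0 ω; positivity, mul_le_of_le_one_right hK0.le (hv1 ω)⟩
  have hbd : ∀ (a : ℝ) ω, 0 ≤ a → a ≤ 1 → |-(a * (K * v ω))| ≤ K := fun a ω ha ha1 => by
    rw [abs_neg, abs_of_nonneg (mul_nonneg ha (hKv ω).1)]
    exact (mul_le_of_le_one_left (hKv ω).1 ha1).trans (hKv ω).2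
  have hb1 : ∀ ω, |-(K * v ω * Real.exp (-(K * v ω)))| ≤ K := fun ω => by
    rw [mul_comm (K * v ω)]
    exact hbd _ ω (Real.exp_pos _).le (Real.exp_le_one_iff.2 (by linarith [(hKv ω).1]))
  have hb2 : ∀ ω, |-(K * v ω)| ≤ K := fun ω => by simpa only [one_mul] using hbd 1 ω zero_le_one le_rfl
  have hb3 : ∀ ω, |-(Real.exp (-K) * (K * v ω))| ≤ K := fun ω =>
    hbd _ ω (Real.exp_pos _).le (Real.exp_le_one_iff.2 (by linarith))
  -- coupled: `∫ −Kve^{−Kv} ≥ −K ∫ v = −K √3/√7`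
  have hlow : -(K * (Real.sqrt 3 / Real.sqrt 7)) ≤
      ∫ ω, -(K * v ω * Real.exp (-(K * v ω))) ∂(regionLaw (id : Fin 2 → Fin 2) (!![2, 1; 1, 2] : Matrix (Fin 2) (Fin 2) ℝ)
        (0 : Fin 2 → ℝ) ({0, 1} : Finset (Fin 2)) ({0, 1} : Finset (Fin 2))) := by
    rw [← hJ1, ← integral_const_mul, ← integral_neg]
    refine integral_mono (hint _ _ (by fun_prop) hb2) (hint _ _ hgc hb1) fun ω => ?_
    have h1 : Real.exp (-(K * v ω)) ≤ 1 := Real.exp_le_one_iff.2 (by have := hv0 ω; nlinarith)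
    have h2 : 0 ≤ K * v ω := by have := hv0 ω; positivity
    show -(K * v ω) ≤ -(K * v ω * Real.exp (-(K * v ω)))
    nlinarith
  -- decoupled: `∫ −Kve^{−Kv} ≤ −e^{−K} K ∫ v = −e^{−K} K √4/√8`
  have hupp : ∫ ω, -(K * v ω * Real.exp (-(K * v ω))) ∂(regionLaw (id : Fin 2 → Fin 2) (!![2, 1; 1, 2] : Matrix (Fin 2) (Fin 2) ℝ)
        (0 : Fin 2 → ℝ) ({0, 1} : Finset (Fin 2)) (∅ : Finset (Fin 2))) ≤ -(Real.exp (-K) * (K * (Real.sqrt 4 / Real.sqrt 8))) := by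
    rw [← hJ0, ← integral_const_mul, ← integral_const_mul, ← integral_neg]
    refine integral_mono (hint _ _ hgc hb1) (hint _ _ (by fun_prop) hb3) fun ω => ?_
    have h1 : Real.exp (-K) ≤ Real.exp (-(K * v ω)) := Real.exp_le_exp.2 (by have := hv1 ω; nlinarith)
    have h2 : 0 ≤ K * v ω := by have := hv0 ω; positivity
    show -(K * v ω * Real.exp (-(K * v ω))) ≤ -(Real.exp (-K) * (K * v ω))
    nlinarith
  -- the located exponent is `3/2`
  have himg : (univ : Finset Unit).image (cubeIn cube₀ ({0, 1} : Finset (Fin 2)) ∘ γ₀) = {0} := by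
    ext z
    simp only [mem_image, mem_univ, true_and, mem_singleton, Function.comp_apply]
    exact ⟨fun ⟨_, hz⟩ => hz.symm, fun hz => ⟨(), hz.symm⟩⟩
  have hsd : ((({0, 1} : Finset (Fin 2)) \ {0}).card : ℝ) = 1 := by
    rw [show (({0, 1} : Finset (Fin 2)) \ {0}) = {1} by ext z; fin_cases z <;> simp, card_singleton, Nat.cast_one]
  rw [himg, hsd, card_univ, Fintype.card_unit, Nat.cast_one] at hmain
  have hθpow : θ ^ ((1 : ℝ) + 1 / 2 * 1) ≤ 32 / 10 ^ 9 := by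
    rw [Real.rpow_add hθ0, Real.rpow_one, show (1 : ℝ) / 2 * 1 = 1 / 2 by norm_num, ← Real.sqrt_eq_rpow]
    have hs : Real.sqrt θ ≤ 32 / 10 ^ 4 := by
      rw [hθ, show (32 : ℝ) / 10 ^ 4 = Real.sqrt ((32 / 10 ^ 4) ^ 2) from (Real.sqrt_sq (by norm_num)).symm]
      exact Real.sqrt_le_sqrt (by norm_num)
    calc θ * Real.sqrt θ ≤ (1 / 10 ^ 5) * (32 / 10 ^ 4) := by rw [hθ] at hs ⊢; gcongr
      _ = 32 / 10 ^ 9 := by norm_num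
  -- the activity is `≥ K((1−K)·0.707 − 0.6547) > 10⁻⁷`
  have heK1 : 1 - K ≤ Real.exp (-K) := by linarith [Real.add_one_le_exp (-K)]
  have hact := (abs_le.1 (hmain.trans hθpow)).2
  have hJ0' : (707 : ℝ) / 1000 * (1 - K) ≤ Real.sqrt 4 / Real.sqrt 8 * Real.exp (-K) :=
    mul_le_mul hw0 heK1 (by rw [hK]; norm_num) (le_trans (by norm_num) hw0)
  rw [hK] at hact hJ0' hlow hupp heK1
  linarith

end Main

end Literature.MathematicalPhysics.QuantumFieldTheory.BalabanImbrieJaffe1984to88.BIJ88Ineq5144PairAdjustmentWitness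

end
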